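import Summits.Ventures.CertifiedArithmetic.Expansions.IncircleStageCModel
import Mathlib.Tactic.Linarith
import Mathlib.Tactic.Positivity
import Mathlib.Tactic.Ring
import Mathlib.Tactic.NormNum

/-!
# INCIRCLE, stage C of `incircleadapt` in the floating-point model: the returned sign is correct

NEW WORK in the sense of this development (the algorithm is Shewchuk's `incircleadapt`, file
`predicates.c`; the model over `ℚ`, the constants' certification, statements and proofs are ours;
nothing here is cited anywhere as a literature fact).  The model `incircleStageC`, its grids and
the early exit are `IncircleStageCModel.lean`.

THE RESULT (`incircleStageC_correct_of_estimate_of_margin`) — GENERIC in the two quantities the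
literature argues about: the relative error bound `δ` of `estimate` on W-expansions of floats
(hypothesis `hest`: `|estimate(e) − Σe| ≤ δ|Σe|`) and the coefficient `K_R` of `|det|` in the error
bound (any `K_R ∈ 2^(−2p) ℤ` satisfying the margin (MR) `δ < (1 − δ)(1 − ε)³ K_R`, hypothesis
`hmarginR`).  Let `p ≥ 5`, `fl` any round-to-nearest into `F(p, emin)` with the `RoundoffBelow 2`
property, the coordinates floats of `F(p, e₀)` with `emin ≤ e₀` and `emin + 3p ≤ 4e₀`, and `tp`
error-free on the formats used.  If stage C, run with `K_C = (44 + 576ε)ε² = iccerrboundC p`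
(Shewchuk's constant), `K_R` and the permanent of stage A, returns `d`, then `d > 0 ↔ (9) > 0` and
`d < 0 ↔ (9) < 0` for the EXACT determinant `incircleDet`; in particular `d ≠ 0`.
INSTANCES: the lane's `δ = 3ε`, `K_R = o3dresulterrbound24 p = (3 + 24ε)ε` (here,
`incircleStageC_correct_of_estimate`); Shewchuk's PRINTED `K_R = resulterrbound p = (3 + 8ε)ε`
with the proved sharp `δ = (5/2)ε`, `p ≥ 5`, in `IncircleStageCCorrect.lean` (`…_correct_printed`).

HOW.  Pure plumbing onto the real-number core `incircle_stageC_sign_of_bounds`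
(`IncircleStageCBounds`): every one of its ~100 hypotheses is a standard-model bound
`|x ∘ y − fl(x ∘ y)| ≤ ε|x ∘ y|` or `≤ ε|fl(x ∘ y)|` of this library (`abs_sub_fl_le_eps_mul_abs`,
`abs_sub_fl_le_eps_mul_abs_fl`) or a sign `0 ≤ fl(x ⊗ x)` (`fl_nonneg`), valid because every
intermediate quantity lies on a grid `2^s ℤ` with `s ≥ emin`: the differences and tails on `2^e₀ ℤ`,
products, squares and lifts on `2^2e₀ ℤ`, the correction terms, the permanent `W` and — by
`ExpansionGrids` and `incircleB_onGrid` — `det = estimate(fin1)` on `2^4e₀ ℤ`, the error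
bound on `2^(4e₀ − 3p) ℤ`; the margin `iccerrboundC_margin` (`p ≥ 5`) and the
hypothesis `hmarginR`, and `|det − B| ≤ δ|B|` is `hest` on the W-expansion `fin1`
(`incircleB_spec`).

HONEST CAVEATS.  (1) `hest`, `hmarginR` are explicit hypotheses (above).  (2) The format hypothesis
`emin + 3p ≤ 4e₀` (one `p` more than stages A and B) keeps `iccerrboundC ⊗ permanent` out of the
subnormal range; for binary64 (`p = 53`, `emin = −1074`) it reads `e₀ ≥ −228`, i.e. coordinates
that are multiples of `2^−228` — the theorem says nothing about smaller (subnormal-scale) inputs,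
nor about overflow (the model has no `+∞`).  (3) `predicates.c`'s `K_R = (3 + 8ε)ε` is
certified for `p ≥ 5` only (`IncircleStageCCorrect`).  (4) Only the SIGN of the returned `d` is
claimed.  (5) Stage D (the exact finish) is not modelled here.

References: J. R. Shewchuk, Discrete Comput. Geom. 18 (1997) 305–363, §4.4, Fig. 24–25, Table 4;
`predicates.c` (public domain), routine `incircleadapt` [Shewchuk1997].
-/

namespace Summit.Ventures.CertifiedArithmetic.Expansions

open Literature.ComputerArithmetic.JeannerodRump2018
open Literature.ComputerArithmetic.BoldoJeannerodMelquiondMuller2023 hiding twoSum twoSum_fst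
  isFloat_twoSum
open Literature.ComputerArithmetic.Shewchuk1997
open Literature.ComputerArithmetic.GraillatLefevreMuller2015 (unitRoundoff_le_of_five_le)

variable {p : ℕ} {emin : ℤ} {fl : ℚ → ℚ}

/-- Grids are closed under doubling (private copy of the helper of `IncircleStageCModel`). -/
private theorem onGrid_two_mul {s : ℤ} {a : ℚ} (h : OnGrid s a) : OnGrid s (2 * a) := by
  obtain ⟨m, rfl⟩ := h; exact ⟨2 * m, by push_cast; ring⟩

/-! ## The stage-C test is sound -/
/-- **THE STAGE-C TEST OF `incircleadapt` IS SOUND — generic in the `estimate` bound `δ` and the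
coefficient `K_R`** (`p ≥ 5`, `fl` a `RoundoffBelow 2` round-to-nearest into `F(p, emin)`,
`0 ≤ δ < 1` with `hest`, `K_R ∈ 2^(−2p) ℤ` with the margin `δ < (1 − δ)(1 − ε)³ K_R` (`hmarginR`),
coordinates in `F(p, e₀)`, `emin ≤ e₀`, `emin + 3p ≤ 4e₀`, two-product exact on the formats used):
if stage C, run with `K_C = iccerrboundC p`, `K_R` and stage A's permanent, returns `d`, then
`d > 0 ↔ (9) > 0` and `d < 0 ↔ (9) < 0` for the exact `incircleDet`; in particular `d ≠ 0`. -/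
theorem incircleStageC_correct_of_estimate_of_margin (hp : 5 ≤ p)
    (hfl : IsRoundNearest p emin fl) (hfl2 : RoundoffBelow 2 fl) {δ KR : ℚ} (hδ0 : 0 ≤ δ)
    (hδ1 : δ < 1) (hKR : OnGrid (-(2 * (p : ℤ))) KR)
    (hmarginR : δ < (1 - δ) * ((1 - unitRoundoff p) ^ 3 * KR))
    (hest : ∀ ⦃l : List ℚ⦄, (∀ x ∈ l, IsFloat p emin x) → IsWeakExpansion l →
      |estimate fl l - l.sum| ≤ δ * |l.sum|)
    {e₀ : ℤ} (he₀ : emin ≤ e₀) (h4p : emin + 3 * p ≤ e₀ + e₀ + e₀ + e₀)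
    {a₁ a₂ b₁ b₂ c₁ c₂ d₁ d₂ : ℚ}
    (ha₁ : IsFloat p e₀ a₁) (ha₂ : IsFloat p e₀ a₂) (hb₁ : IsFloat p e₀ b₁)
    (hb₂ : IsFloat p e₀ b₂) (hc₁ : IsFloat p e₀ c₁) (hc₂ : IsFloat p e₀ c₂)
    (hd₁ : IsFloat p e₀ d₁) (hd₂ : IsFloat p e₀ d₂)
    {tp : ℚ → ℚ → ℚ × ℚ}
    (htp : ∀ x y, IsFloat p e₀ x → IsFloat p e₀ y → ExactTwoProd p emin fl tp x y)
    (htp' : ∀ x y, IsFloat p (e₀ + e₀) x → IsFloat p e₀ y → ExactTwoProd p emin fl tp x y)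
    (htp'' : ∀ x y, IsFloat p (e₀ + e₀ + e₀) x → IsFloat p e₀ y → ExactTwoProd p emin fl tp x y)
    {d : ℚ}
    (hC : incircleStageC tp fl (iccerrboundC p) KR
      (incirclePermanent fl a₁ a₂ b₁ b₂ c₁ c₂ d₁ d₂) a₁ a₂ b₁ b₂ c₁ c₂ d₁ d₂ = some d) :
    (0 < d ↔ 0 < incircleDet a₁ a₂ b₁ b₂ c₁ c₂ d₁ d₂) ∧
      (d < 0 ↔ incircleDet a₁ a₂ b₁ b₂ c₁ c₂ d₁ d₂ < 0) := by
  have hp1 : 1 ≤ p := le_trans (by norm_num) hp; have hp4 : 4 ≤ p := le_trans (by norm_num) hp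
  have he₂ : emin ≤ e₀ + e₀ := (by omega); have he₃ : emin ≤ e₀ + e₀ + e₀ := by omega
  have he₄' : emin ≤ e₀ + e₀ + e₀ + e₀ := by omega
  have he₄ : emin ≤ e₀ + e₀ + (e₀ + e₀) := by omega
  have he₅ : emin ≤ -(2 * (p : ℤ)) + (e₀ + e₀ + (e₀ + e₀)) := by omega
  have he₆ : emin ≤ -(3 * (p : ℤ)) + (e₀ + e₀ + (e₀ + e₀)) := by omega
  have hu0 : 0 < unitRoundoff p := by unfold unitRoundoff; positivity
  have hu32 : unitRoundoff p ≤ 1 / 32 := unitRoundoff_le_of_five_le hp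
  have hu2 : unitRoundoff p ≤ 1 / 2 := by linarith
  have hmarginC := iccerrboundC_margin hp
  -- grids: the six differences (`2^e₀ ℤ`), their roundings (floats of `F(p, e₀)`), their tails
  have gta₁ := (OnGrid.of_isFloat ha₁).sub (OnGrid.of_isFloat hd₁)
  have gta₂ := (OnGrid.of_isFloat ha₂).sub (OnGrid.of_isFloat hd₂)
  have gtb₁ := (OnGrid.of_isFloat hb₁).sub (OnGrid.of_isFloat hd₁)
  have gtb₂ := (OnGrid.of_isFloat hb₂).sub (OnGrid.of_isFloat hd₂)
  have gtc₁ := (OnGrid.of_isFloat hc₁).sub (OnGrid.of_isFloat hd₁)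
  have gtc₂ := (OnGrid.of_isFloat hc₂).sub (OnGrid.of_isFloat hd₂)
  have gxa₁ := gta₁.fl_of hp1 hfl he₀
  have gxa₂ := gta₂.fl_of hp1 hfl he₀
  have gxb₁ := gtb₁.fl_of hp1 hfl he₀
  have gxb₂ := gtb₂.fl_of hp1 hfl he₀
  have gxc₁ := gtc₁.fl_of hp1 hfl he₀
  have gxc₂ := gtc₂.fl_of hp1 hfl he₀
  have fxa₁ : IsFloat p e₀ (fl (a₁ - d₁)) := isFloat_of_isFloat_of_onGrid (hfl _).1 gxa₁
  have fxa₂ : IsFloat p e₀ (fl (a₂ - d₂)) := isFloat_of_isFloat_of_onGrid (hfl _).1 gxa₂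
  have fxb₁ : IsFloat p e₀ (fl (b₁ - d₁)) := isFloat_of_isFloat_of_onGrid (hfl _).1 gxb₁
  have fxb₂ : IsFloat p e₀ (fl (b₂ - d₂)) := isFloat_of_isFloat_of_onGrid (hfl _).1 gxb₂
  have fxc₁ : IsFloat p e₀ (fl (c₁ - d₁)) := isFloat_of_isFloat_of_onGrid (hfl _).1 gxc₁
  have fxc₂ : IsFloat p e₀ (fl (c₂ - d₂)) := isFloat_of_isFloat_of_onGrid (hfl _).1 gxc₂
  have gτa₁ := gta₁.sub gxa₁
  have gτa₂ := gta₂.sub gxa₂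
  have gτb₁ := gtb₁.sub gxb₁
  have gτb₂ := gtb₂.sub gxb₂
  have gτc₁ := gtc₁.sub gxc₁
  have gτc₂ := gtc₂.sub gxc₂
  -- the six products and six squares of stage A and their roundings, the lifts (`2^2e₀ ℤ`)
  have gp₁ := gxb₁.mul gxc₂
  have gp₂ := gxc₁.mul gxb₂
  have gp₃ := gxc₁.mul gxa₂
  have gp₄ := gxa₁.mul gxc₂
  have gp₅ := gxa₁.mul gxb₂
  have gp₆ := gxb₁.mul gxa₂
  have gP₁ := gp₁.fl_of hp1 hfl he₂
  have gP₂ := gp₂.fl_of hp1 hfl he₂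
  have gP₃ := gp₃.fl_of hp1 hfl he₂
  have gP₄ := gp₄.fl_of hp1 hfl he₂
  have gP₅ := gp₅.fl_of hp1 hfl he₂
  have gP₆ := gp₆.fl_of hp1 hfl he₂
  have gka₁ := gxa₁.mul gxa₁
  have gka₂ := gxa₂.mul gxa₂
  have gkb₁ := gxb₁.mul gxb₁
  have gkb₂ := gxb₂.mul gxb₂
  have gkc₁ := gxc₁.mul gxc₁
  have gkc₂ := gxc₂.mul gxc₂
  have gSqa₁ := gka₁.fl_of hp1 hfl he₂
  have gSqa₂ := gka₂.fl_of hp1 hfl he₂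
  have gSqb₁ := gkb₁.fl_of hp1 hfl he₂
  have gSqb₂ := gkb₂.fl_of hp1 hfl he₂
  have gSqc₁ := gkc₁.fl_of hp1 hfl he₂
  have gSqc₂ := gkc₂.fl_of hp1 hfl he₂
  have gla := gSqa₁.add gSqa₂
  have glb := gSqb₁.add gSqb₂
  have glc := gSqc₁.add gSqc₂
  have gLa := gla.fl_of hp1 hfl he₂
  have gLb := glb.fl_of hp1 hfl he₂
  have gLc := glc.fl_of hp1 hfl he₂
  -- term a: products `2^2e₀ ℤ`, sums, lift ⊗ r and (2g) ⊗ e (`2^4e₀ ℤ`)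
  have gqa₁ := gxb₁.mul gτc₂
  have gqa₂ := gxc₂.mul gτb₁
  have gqa₃ := gxb₂.mul gτc₁
  have gqa₄ := gxc₁.mul gτb₂
  have gfa₁ := gqa₁.fl_of hp1 hfl he₂
  have gfa₂ := gqa₂.fl_of hp1 hfl he₂
  have gfa₃ := gqa₃.fl_of hp1 hfl he₂
  have gfa₄ := gqa₄.fl_of hp1 hfl he₂
  have gsa₁ := gfa₁.add gfa₂
  have gsa₂ := gfa₃.add gfa₄
  have gSa₁ := gsa₁.fl_of hp1 hfl he₂
  have gSa₂ := gsa₂.fl_of hp1 hfl he₂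
  have gra := gSa₁.sub gSa₂
  have gRa := gra.fl_of hp1 hfl he₂
  have gga₁ := gxa₁.mul gτa₁
  have gga₂ := gxa₂.mul gτa₂
  have gGa₁ := gga₁.fl_of hp1 hfl he₂
  have gGa₂ := gga₂.fl_of hp1 hfl he₂
  have gga := gGa₁.add gGa₂
  have gGa := gga.fl_of hp1 hfl he₂
  have gma := gLa.mul gRa
  have gMa := gma.fl_of hp1 hfl he₄
  have gea := gP₁.sub gP₂
  have gEa := gea.fl_of hp1 hfl he₂
  have gna := (onGrid_two_mul gGa).mul gEa
  have gNa := gna.fl_of hp1 hfl he₄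
  have gua := gMa.add gNa
  have gTa := gua.fl_of hp1 hfl he₄
  -- term b
  have gqb₁ := gxc₁.mul gτa₂
  have gqb₂ := gxa₂.mul gτc₁
  have gqb₃ := gxc₂.mul gτa₁
  have gqb₄ := gxa₁.mul gτc₂
  have gfb₁ := gqb₁.fl_of hp1 hfl he₂
  have gfb₂ := gqb₂.fl_of hp1 hfl he₂
  have gfb₃ := gqb₃.fl_of hp1 hfl he₂
  have gfb₄ := gqb₄.fl_of hp1 hfl he₂
  have gsb₁ := gfb₁.add gfb₂
  have gsb₂ := gfb₃.add gfb₄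
  have gSb₁ := gsb₁.fl_of hp1 hfl he₂
  have gSb₂ := gsb₂.fl_of hp1 hfl he₂
  have grb := gSb₁.sub gSb₂
  have gRb := grb.fl_of hp1 hfl he₂
  have ggb₁ := gxb₁.mul gτb₁
  have ggb₂ := gxb₂.mul gτb₂
  have gGb₁ := ggb₁.fl_of hp1 hfl he₂
  have gGb₂ := ggb₂.fl_of hp1 hfl he₂
  have ggb := gGb₁.add gGb₂
  have gGb := ggb.fl_of hp1 hfl he₂
  have gmb := gLb.mul gRb
  have gMb := gmb.fl_of hp1 hfl he₄
  have geb := gP₃.sub gP₄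
  have gEb := geb.fl_of hp1 hfl he₂
  have gnb := (onGrid_two_mul gGb).mul gEb
  have gNb := gnb.fl_of hp1 hfl he₄
  have gub := gMb.add gNb
  have gTb := gub.fl_of hp1 hfl he₄
  -- term c
  have gqc₁ := gxa₁.mul gτb₂
  have gqc₂ := gxb₂.mul gτa₁
  have gqc₃ := gxa₂.mul gτb₁
  have gqc₄ := gxb₁.mul gτa₂
  have gfc₁ := gqc₁.fl_of hp1 hfl he₂
  have gfc₂ := gqc₂.fl_of hp1 hfl he₂
  have gfc₃ := gqc₃.fl_of hp1 hfl he₂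
  have gfc₄ := gqc₄.fl_of hp1 hfl he₂
  have gsc₁ := gfc₁.add gfc₂
  have gsc₂ := gfc₃.add gfc₄
  have gSc₁ := gsc₁.fl_of hp1 hfl he₂
  have gSc₂ := gsc₂.fl_of hp1 hfl he₂
  have grc := gSc₁.sub gSc₂
  have gRc := grc.fl_of hp1 hfl he₂
  have ggc₁ := gxc₁.mul gτc₁
  have ggc₂ := gxc₂.mul gτc₂
  have gGc₁ := ggc₁.fl_of hp1 hfl he₂
  have gGc₂ := ggc₂.fl_of hp1 hfl he₂
  have ggc := gGc₁.add gGc₂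
  have gGc := ggc.fl_of hp1 hfl he₂
  have gmc := gLc.mul gRc
  have gMc := gmc.fl_of hp1 hfl he₄
  have gec := gP₅.sub gP₆
  have gEc := gec.fl_of hp1 hfl he₂
  have gnc := (onGrid_two_mul gGc).mul gEc
  have gNc := gnc.fl_of hp1 hfl he₄
  have guc := gMc.add gNc
  have gTc := guc.fl_of hp1 hfl he₄
  -- the sum of the three terms (`2^4e₀ ℤ`)
  have gv₁ := gTa.add gTb
  have gV₁ := gv₁.fl_of hp1 hfl he₄
  have gv := gV₁.add gTc
  have gV := gv.fl_of hp1 hfl he₄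
  -- the permanent chain (stage A): `A_a = fl(|P₁| + |P₂|)`, `α_a = fl(A_a · alift)`, `W₁`, `W`
  have gAsa := gP₁.abs.add gP₂.abs
  have gAsb := gP₃.abs.add gP₄.abs
  have gAsc := gP₅.abs.add gP₆.abs
  have gAa := gAsa.fl_of hp1 hfl he₂
  have gAb := gAsb.fl_of hp1 hfl he₂
  have gAc := gAsc.fl_of hp1 hfl he₂
  have gala := gAa.mul gLa
  have galb := gAb.mul gLb
  have galc := gAc.mul gLc
  have gαa := gala.fl_of hp1 hfl he₄
  have gαb := galb.fl_of hp1 hfl he₄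
  have gαc := galc.fl_of hp1 hfl he₄
  have gw₁ := gαa.add gαb
  have gW₁ := gw₁.fl_of hp1 hfl he₄
  have gw := gW₁.add gαc
  have gW := gw.fl_of hp1 hfl he₄
  -- signs of the computed squares and lifts
  have sSa₁ : 0 ≤ fl (fl (a₁ - d₁) * fl (a₁ - d₁)) := fl_nonneg hfl (mul_self_nonneg _)
  have sSa₂ : 0 ≤ fl (fl (a₂ - d₂) * fl (a₂ - d₂)) := fl_nonneg hfl (mul_self_nonneg _)
  have sSb₁ : 0 ≤ fl (fl (b₁ - d₁) * fl (b₁ - d₁)) := fl_nonneg hfl (mul_self_nonneg _)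
  have sSb₂ : 0 ≤ fl (fl (b₂ - d₂) * fl (b₂ - d₂)) := fl_nonneg hfl (mul_self_nonneg _)
  have sSc₁ : 0 ≤ fl (fl (c₁ - d₁) * fl (c₁ - d₁)) := fl_nonneg hfl (mul_self_nonneg _)
  have sSc₂ : 0 ≤ fl (fl (c₂ - d₂) * fl (c₂ - d₂)) := fl_nonneg hfl (mul_self_nonneg _)
  have sLa := fl_nonneg hfl (add_nonneg sSa₁ sSa₂)
  have sLb := fl_nonneg hfl (add_nonneg sSb₁ sSb₂)
  have sLc := fl_nonneg hfl (add_nonneg sSc₁ sSc₂)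
  -- `det = estimate(fin1)` on `2^4e₀ ℤ`, `det' = det ⊕ detadd`, the error bound on `2^(4e₀ − 3p) ℤ`
  have gdB : OnGrid (e₀ + e₀ + (e₀ + e₀)) (estimate fl (incircleB tp fl (fl (a₁ - d₁))
      (fl (a₂ - d₂)) (fl (b₁ - d₁)) (fl (b₂ - d₂)) (fl (c₁ - d₁)) (fl (c₂ - d₂)))) :=
    (onGrid_estimate hp1 hfl he₄' (incircleB_onGrid hp4 hfl hfl2 he₂ he₃ he₄' htp htp' htp''
      fxa₁ fxa₂ fxb₁ fxb₂ fxc₁ fxc₂)).mono (by omega)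
  have gdc := gdB.add gV
  have hdC := abs_sub_fl_le_eps_mul_abs_fl hp1 hfl he₄ gdc
  rw [abs_sub_comm] at hdC
  have gKW := (onGrid_iccerrboundC p).mul gW
  have gKd := hKR.mul gdB.abs
  have gE₁ := gKW.fl_of hp1 hfl he₆
  have gE₂ := (gKd.fl_of hp1 hfl he₅).mono (show -(3 * (p : ℤ)) + (e₀ + e₀ + (e₀ + e₀))
    ≤ -(2 * (p : ℤ)) + (e₀ + e₀ + (e₀ + e₀)) by omega)
  have gE := gE₁.add gE₂
  -- `fin1` is a W-expansion of floats with sum `B`; `det = estimate fin1 = B ± δB`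
  obtain ⟨hW, hS, hF, -, -, -⟩ :=
    incircleB_spec hp4 hfl hfl2 he₂ he₃ he₄' htp htp' htp'' fxa₁ fxa₂ fxb₁ fxb₂ fxc₁ fxc₂
  have hest := hest hF hW
  rw [hS] at hest
  unfold incircleDetB at hest
  -- the doubling of a float is exact
  have h2 : ∀ t : ℚ, fl (2 * fl t) = 2 * fl t := fun t => fl_eq_self hfl (isFloat_two_mul (hfl t).1)
  -- stage C returned: the test passed and `d = det'`
  unfold incircleStageC at hC
  simp only [] at hC
  split_ifs at hC with htest
  obtain rfl := Option.some.inj hC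
  simp only [incirclePermanent, h2] at htest
  simp only [h2]
  have key := incircle_stageC_sign_of_bounds hu0 hu2 hδ0 hδ1 hmarginC hmarginR
    (abs_sub_fl_le_eps_mul_abs_fl hp1 hfl he₀ gta₁) (abs_sub_fl_le_eps_mul_abs_fl hp1 hfl he₀ gta₂)
    (abs_sub_fl_le_eps_mul_abs_fl hp1 hfl he₀ gtb₁) (abs_sub_fl_le_eps_mul_abs_fl hp1 hfl he₀ gtb₂)
    (abs_sub_fl_le_eps_mul_abs_fl hp1 hfl he₀ gtc₁) (abs_sub_fl_le_eps_mul_abs_fl hp1 hfl he₀ gtc₂)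
    (abs_sub_fl_le_eps_mul_abs_fl hp1 hfl he₂ gp₁) (abs_sub_fl_le_eps_mul_abs_fl hp1 hfl he₂ gp₂)
    (abs_sub_fl_le_eps_mul_abs_fl hp1 hfl he₂ gp₃) (abs_sub_fl_le_eps_mul_abs_fl hp1 hfl he₂ gp₄)
    (abs_sub_fl_le_eps_mul_abs_fl hp1 hfl he₂ gp₅) (abs_sub_fl_le_eps_mul_abs_fl hp1 hfl he₂ gp₆)
    (abs_sub_fl_le_eps_mul_abs_fl hp1 hfl he₂ gka₁) (abs_sub_fl_le_eps_mul_abs_fl hp1 hfl he₂ gka₂)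
    (abs_sub_fl_le_eps_mul_abs_fl hp1 hfl he₂ gkb₁) (abs_sub_fl_le_eps_mul_abs_fl hp1 hfl he₂ gkb₂)
    (abs_sub_fl_le_eps_mul_abs_fl hp1 hfl he₂ gkc₁) (abs_sub_fl_le_eps_mul_abs_fl hp1 hfl he₂ gkc₂)
    sSa₁ sSa₂ sSb₁ sSb₂ sSc₁ sSc₂
    (abs_sub_fl_le_eps_mul_abs_fl hp1 hfl he₂ gla) (abs_sub_fl_le_eps_mul_abs_fl hp1 hfl he₂ glb)
    (abs_sub_fl_le_eps_mul_abs_fl hp1 hfl he₂ glc) sLa sLb sLc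
    -- term a
    (abs_sub_fl_le_eps_mul_abs hp1 hfl he₂ gqa₁) (abs_sub_fl_le_eps_mul_abs hp1 hfl he₂ gqa₂)
    (abs_sub_fl_le_eps_mul_abs hp1 hfl he₂ gqa₃) (abs_sub_fl_le_eps_mul_abs hp1 hfl he₂ gqa₄)
    (abs_sub_fl_le_eps_mul_abs hp1 hfl he₂ gsa₁) (abs_sub_fl_le_eps_mul_abs hp1 hfl he₂ gsa₂)
    (abs_sub_fl_le_eps_mul_abs hp1 hfl he₂ gra) (abs_sub_fl_le_eps_mul_abs hp1 hfl he₂ gga₁)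
    (abs_sub_fl_le_eps_mul_abs hp1 hfl he₂ gga₂) (abs_sub_fl_le_eps_mul_abs hp1 hfl he₂ gga)
    (abs_sub_fl_le_eps_mul_abs hp1 hfl he₄ gma) (abs_sub_fl_le_eps_mul_abs hp1 hfl he₂ gea)
    (abs_sub_fl_le_eps_mul_abs hp1 hfl he₄ gna) (abs_sub_fl_le_eps_mul_abs hp1 hfl he₄ gua)
    -- term b
    (abs_sub_fl_le_eps_mul_abs hp1 hfl he₂ gqb₁) (abs_sub_fl_le_eps_mul_abs hp1 hfl he₂ gqb₂)
    (abs_sub_fl_le_eps_mul_abs hp1 hfl he₂ gqb₃) (abs_sub_fl_le_eps_mul_abs hp1 hfl he₂ gqb₄)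
    (abs_sub_fl_le_eps_mul_abs hp1 hfl he₂ gsb₁) (abs_sub_fl_le_eps_mul_abs hp1 hfl he₂ gsb₂)
    (abs_sub_fl_le_eps_mul_abs hp1 hfl he₂ grb) (abs_sub_fl_le_eps_mul_abs hp1 hfl he₂ ggb₁)
    (abs_sub_fl_le_eps_mul_abs hp1 hfl he₂ ggb₂) (abs_sub_fl_le_eps_mul_abs hp1 hfl he₂ ggb)
    (abs_sub_fl_le_eps_mul_abs hp1 hfl he₄ gmb) (abs_sub_fl_le_eps_mul_abs hp1 hfl he₂ geb)
    (abs_sub_fl_le_eps_mul_abs hp1 hfl he₄ gnb) (abs_sub_fl_le_eps_mul_abs hp1 hfl he₄ gub)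
    -- term c
    (abs_sub_fl_le_eps_mul_abs hp1 hfl he₂ gqc₁) (abs_sub_fl_le_eps_mul_abs hp1 hfl he₂ gqc₂)
    (abs_sub_fl_le_eps_mul_abs hp1 hfl he₂ gqc₃) (abs_sub_fl_le_eps_mul_abs hp1 hfl he₂ gqc₄)
    (abs_sub_fl_le_eps_mul_abs hp1 hfl he₂ gsc₁) (abs_sub_fl_le_eps_mul_abs hp1 hfl he₂ gsc₂)
    (abs_sub_fl_le_eps_mul_abs hp1 hfl he₂ grc) (abs_sub_fl_le_eps_mul_abs hp1 hfl he₂ ggc₁)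
    (abs_sub_fl_le_eps_mul_abs hp1 hfl he₂ ggc₂) (abs_sub_fl_le_eps_mul_abs hp1 hfl he₂ ggc)
    (abs_sub_fl_le_eps_mul_abs hp1 hfl he₄ gmc) (abs_sub_fl_le_eps_mul_abs hp1 hfl he₂ gec)
    (abs_sub_fl_le_eps_mul_abs hp1 hfl he₄ gnc) (abs_sub_fl_le_eps_mul_abs hp1 hfl he₄ guc)
    -- the sum, the permanent, the estimate, `det'`, the error bound, the test
    (abs_sub_fl_le_eps_mul_abs hp1 hfl he₄ gv₁) (abs_sub_fl_le_eps_mul_abs hp1 hfl he₄ gv)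
    (abs_sub_fl_le_eps_mul_abs hp1 hfl he₂ gAsa) (abs_sub_fl_le_eps_mul_abs hp1 hfl he₂ gAsb)
    (abs_sub_fl_le_eps_mul_abs hp1 hfl he₂ gAsc)
    (abs_sub_fl_le_eps_mul_abs hp1 hfl he₄ gala) (abs_sub_fl_le_eps_mul_abs hp1 hfl he₄ galb)
    (abs_sub_fl_le_eps_mul_abs hp1 hfl he₄ galc)
    (abs_sub_fl_le_eps_mul_abs hp1 hfl he₄ gw₁) (abs_sub_fl_le_eps_mul_abs hp1 hfl he₄ gw)
    (abs_sub_fl_le_eps_mul_abs hp1 hfl he₆ gKW)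
    hest hdC (abs_sub_fl_le_eps_mul_abs hp1 hfl he₅ gKd) (abs_sub_fl_le_eps_mul_abs hp1 hfl he₆ gE)
    (htest.elim (fun h => le_trans h (le_abs_self _)) (fun h => le_trans h (neg_le_abs _)))
  have hT : incircleDet a₁ a₂ b₁ b₂ c₁ c₂ d₁ d₂
      = ((fl (a₁ - d₁) + (a₁ - d₁ - fl (a₁ - d₁))) * (fl (a₁ - d₁) + (a₁ - d₁ - fl (a₁ - d₁)))
          + (fl (a₂ - d₂) + (a₂ - d₂ - fl (a₂ - d₂))) * (fl (a₂ - d₂) + (a₂ - d₂ - fl (a₂ - d₂))))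
          * ((fl (b₁ - d₁) + (b₁ - d₁ - fl (b₁ - d₁))) * (fl (c₂ - d₂) + (c₂ - d₂ - fl (c₂ - d₂)))
            - (fl (c₁ - d₁) + (c₁ - d₁ - fl (c₁ - d₁))) * (fl (b₂ - d₂) + (b₂ - d₂ - fl (b₂ - d₂))))
        + ((fl (b₁ - d₁) + (b₁ - d₁ - fl (b₁ - d₁))) * (fl (b₁ - d₁) + (b₁ - d₁ - fl (b₁ - d₁)))
          + (fl (b₂ - d₂) + (b₂ - d₂ - fl (b₂ - d₂))) * (fl (b₂ - d₂) + (b₂ - d₂ - fl (b₂ - d₂))))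
          * ((fl (c₁ - d₁) + (c₁ - d₁ - fl (c₁ - d₁))) * (fl (a₂ - d₂) + (a₂ - d₂ - fl (a₂ - d₂)))
            - (fl (a₁ - d₁) + (a₁ - d₁ - fl (a₁ - d₁))) * (fl (c₂ - d₂) + (c₂ - d₂ - fl (c₂ - d₂))))
        + ((fl (c₁ - d₁) + (c₁ - d₁ - fl (c₁ - d₁))) * (fl (c₁ - d₁) + (c₁ - d₁ - fl (c₁ - d₁)))
          + (fl (c₂ - d₂) + (c₂ - d₂ - fl (c₂ - d₂))) * (fl (c₂ - d₂) + (c₂ - d₂ - fl (c₂ - d₂))))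
          * ((fl (a₁ - d₁) + (a₁ - d₁ - fl (a₁ - d₁))) * (fl (b₂ - d₂) + (b₂ - d₂ - fl (b₂ - d₂)))
            - (fl (b₁ - d₁) + (b₁ - d₁ - fl (b₁ - d₁)))
              * (fl (a₂ - d₂) + (a₂ - d₂ - fl (a₂ - d₂)))) := by
    unfold incircleDet; ring
  rw [hT]
  exact key

/-- **The lane's instance `δ = 3ε`, `K_R = o3dresulterrbound24 p = (3 + 24ε)ε`**: stage C is sound
given the `3ε` relative error bound of `estimate` on W-expansions of floats (`hest3`, the
conclusion of `EstimateRelativeError`; `p ≥ 5`). -/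
theorem incircleStageC_correct_of_estimate (hp : 5 ≤ p) (hfl : IsRoundNearest p emin fl)
    (hfl2 : RoundoffBelow 2 fl)
    (hest3 : ∀ ⦃l : List ℚ⦄, (∀ x ∈ l, IsFloat p emin x) → IsWeakExpansion l →
      |estimate fl l - l.sum| ≤ 3 * unitRoundoff p * |l.sum|)
    {e₀ : ℤ} (he₀ : emin ≤ e₀) (h4p : emin + 3 * p ≤ e₀ + e₀ + e₀ + e₀)
    {a₁ a₂ b₁ b₂ c₁ c₂ d₁ d₂ : ℚ}
    (ha₁ : IsFloat p e₀ a₁) (ha₂ : IsFloat p e₀ a₂) (hb₁ : IsFloat p e₀ b₁)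
    (hb₂ : IsFloat p e₀ b₂) (hc₁ : IsFloat p e₀ c₁) (hc₂ : IsFloat p e₀ c₂)
    (hd₁ : IsFloat p e₀ d₁) (hd₂ : IsFloat p e₀ d₂)
    {tp : ℚ → ℚ → ℚ × ℚ}
    (htp : ∀ x y, IsFloat p e₀ x → IsFloat p e₀ y → ExactTwoProd p emin fl tp x y)
    (htp' : ∀ x y, IsFloat p (e₀ + e₀) x → IsFloat p e₀ y → ExactTwoProd p emin fl tp x y)
    (htp'' : ∀ x y, IsFloat p (e₀ + e₀ + e₀) x → IsFloat p e₀ y → ExactTwoProd p emin fl tp x y)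
    {d : ℚ}
    (hC : incircleStageC tp fl (iccerrboundC p) (o3dresulterrbound24 p)
      (incirclePermanent fl a₁ a₂ b₁ b₂ c₁ c₂ d₁ d₂) a₁ a₂ b₁ b₂ c₁ c₂ d₁ d₂ = some d) :
    (0 < d ↔ 0 < incircleDet a₁ a₂ b₁ b₂ c₁ c₂ d₁ d₂) ∧
      (d < 0 ↔ incircleDet a₁ a₂ b₁ b₂ c₁ c₂ d₁ d₂ < 0) := by
  have hp4 : 4 ≤ p := le_trans (by norm_num) hp
  have hu0 : 0 < unitRoundoff p := by unfold unitRoundoff; positivity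
  have hu32 : unitRoundoff p ≤ 1 / 32 := unitRoundoff_le_of_five_le hp
  exact incircleStageC_correct_of_estimate_of_margin hp hfl hfl2 (by positivity) (by linarith)
    (onGrid_o3dresulterrbound24 p) (o3dresulterrbound24_margin hp4) hest3 he₀ h4p ha₁ ha₂ hb₁ hb₂
    hc₁ hc₂ hd₁ hd₂ htp htp' htp'' hC

end Summit.Ventures.CertifiedArithmetic.Expansions
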